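import Summits.QuantumFields.YangMills.Theorems.BalabanUVNodesKLCPrAtHierFrameRows
import Summits.QuantumFields.YangMills.Theorems.BalabanUVNodesN07QprOfRecordOntoGuarded
import Summits.QuantumFields.YangMills.Theorems.BalabanUVNodesN07JOfRecordBoundOfThm1Class
import HarnessLib

/-!
# THE GL PIN, GUARDED EDITION — ✓`prop4UniformPrAtRecord_node00_of_prop5Clause_hierFrameGLRec_of_entryRows` (✓p833890 §2) with {W1}'s framed onto row `hQ`, the current letter
# `‖J(U₀)‖ ≤ nJ` and the window `hq` REDUCED BY NAME: `hQ` ⟸ the un-framed onto row of [B7] Sect. E, `nJ := ε₀` ⟸ [B11] (2)'s class `InUkClassB11`, window k-FREE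

Cell `pub-ymgap` ∕ `ym-nodeO-ideate`, porter lineage `ymgap-nodeO-port-PTB-1` (gen 12), offers (O5)(O6)(O8) of the lineage's LANDED line (nodeO STATUS 2026-08-31T20:42Z) folded into ONE
edition.  `--kind proof --supports stmt-QuantumFields-27238 --as helper`; count-neutral; NEW basename; ✓`…KLCPrAtHierFrameRows`, ✓`…N07QprOfRecordOntoGuarded`, ✓`…N07JOfRecordBoundOfThm1Class`
NOT edited.  [B7] = [Balaban1985Averaging]; [B9] = [Balaban1985BackgroundPropagators]; [B11] = [Balaban1985Variational].

WHAT IS PROVED (0 def, 0 sorry, axioms standard; ns `Summit.QuantumFields.YangMills.Theorems.KExpOfRecordPr`; node-00, `0 < k ≤ m + K`):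
* §1 ★★★ `prop4UniformPrAtRecord_node00_of_prop5Clause_hierFrameGLRec_of_entryRows_guarded` — the GL pin whose displayed letters are: `hpos` ({W1}: the framed Laplacian
  `Δ_a(Q^{pr}(U₀;𝔥ᴳᴸ), Q′(U₀))` positive), `hqon : Function.Surjective (qCplxOp k U₀)` (the UN-FRAMED onto row; the framed `hQ` is DERIVED inside the statement by
  ✓`QprOfRecord_surjective_hierFrameGL_of_qCplxOp … (loopProfile_of_regular_below …).1 hqon` — proof-irrelevant, so consumers' `h0∕h1` at any `hQ` still fit), {W2} `h0∕h1`, {W3} `hS∕hR`,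
  {W4} `h157` + `r + r ≤ α₁`, the window in k-FREE form `(r+r)·b·2dC₃ ≤ ½` (`b := B₀d(2(1+1∕ρ))^d`; `(L^d)^k·η_k^d = 1`), `InUkClassB11 F N K k ε₀ U₀` ([B11] (2) at `Ω_j = T`; gives
  `‖J(U₀)‖₍₋₃₎ ≤ ε₀` by ✓`norm_JOfRecordAtBg_le_of_inUkClassB11`), print's (14) `hreg`, `∀ x, x ∈ Ω_k`, numeric rows (`0 < α`, `α·1.1e7·N ≤ 1`, `0 ≤ B₀`, `0 < ρ`, `0 ≤ C₃`, `0 ≤ C_π`,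
  `0 < σ`, `0 ≤ ε₀`); conclusion `Prop4UniformPrAtRecord … r Gp E R′` with `nJ := ε₀` in `E`.
NB (located, PT-B g12 ledger memo): `InUkClassB11` is (2) for `U₀` ITSELF at the fine scale; `hreg` is (14) for the AVERAGED backgrounds `Ū^j` — different letters, both displayed.

HONEST FRAMING.  Glue BY NAME + one line of arithmetic (`L^kη_k = 1`); {W1} `hpos`∕`hqon`, {W2}, {W3}, {W4}, `InUkClassB11 … U₀`, `hreg` are DISPLAYED hypotheses INHABITED NOWHERE at a
generic background (at `U₀ = 1`: ✓`qCplxOp_one_surjective`, ✓`laplaceAOfRecord_one_pos_iff`, `J(1) = 0`); nothing of [B7] Prop. 5 ∕ Sect. E, [B9] Thm 3.12, [B11] Thm 1 ∕ (72)–(73) ∕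
Prop. 4 is proved here; K0ᴬ ⟨stmt-QuantumFields-27238⟩ NOT closed (0∕2); ⟨27931⟩ CLOSED·IMPLICATION-ONLY; NODE O 0∕1; COUNT 8∕28 · K 1∕4 UNMOVED; one finite `𝕋⁴_{L^K}` programme at
fixed ε — NOT continuum ∕ ℝ⁴ ∕ OS ∕ Clay; **the Yang–Mills mass gap (Clay) is NOT proved by any of this.**  No `sorry`, `instance`, `notation`, `set_option`; standard axioms.
-/

noncomputable section

open scoped Matrix Matrix.Norms.L2Operator InnerProductSpace ComplexConjugate BigOperators
open Classical

namespace Summit.QuantumFields.YangMills.Theorems.KExpOfRecordPr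

open Literature.MathematicalPhysics.QuantumFieldTheory.Balaban1983to89
open Literature.MathematicalPhysics.QuantumFieldTheory.Balaban1983to89.Node00
open Summit.QuantumFields.YangMills.Theorems.KExpOfRecord (KRecIdx kexpOfRecord)
open T4Continuum BlockAveraging
open B11Eq103H1Complex (SiteL2K)
open B9SectCLatticeCarrier (Bond)
open B11Eq115Space (NegSup NegSize JetSup levWeight levWeight_apply)
open B11Eq111FrakG (nabla115)
open Summit.QuantumFields.YangMills.BalabanUVNodes.N07Prop4LetterHOfThm312 (blkOfBond)
open Summit.QuantumFields.YangMills.BalabanUVNodes.N07KernelEntriesOfRecord (entry0 entry1 nColOp)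
open Summit.QuantumFields.YangMills.BalabanUVNodes.N07KLNOfLocalityRows (blockRow0 blockRow1)

variable (F : T4Family) (N : ℕ) [NeZero N]

/-! ## §0  `(L^d)^k · η_k^d = 1` — why the window and the products `Θ_H·G`, `Θ′·G` in the pins' constant `E` are k-free -/

/-- **`#blocks(k) · η_k^d = 1`**: `((L^d)^k : ℕ) · η_k^d = 1` for `η_k = L^{−k}` — so in every pin of this lineage `Θ_H·G = b·2dC₃` and `Θ′·G = N₁·2dC₃` (the displayed
`(L^d)^k` of ✓`klH_of_entryBounds`∕✓`klN_of_nEntryBounds` is cancelled by the `η_k^d` of (KL-C)'s `G`), i.e. the constant `E` of `Prop4UniformPrAtRecord … E R′` is k-FREE in value.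
The inner step `L^k · η_k = 1` is lit ✓`B12Eq115BackgroundPair.pow_mul_eta` (same two-line proof, inlined to keep the import list short).
[cite: Balaban1987RG1, (1.2) p.260; Balaban1985Variational, (5) p.278, Prop. 4 p.292 («uniformly in k»)] -/
theorem natCast_blocks_mul_eta_pow_eq_one (P : Params) (k : ℕ) : (((P.L ^ P.d) ^ k : ℕ) : ℝ) * P.eta k ^ P.d = 1 := by
  have hLη : (P.L : ℝ) ^ k * P.eta k = 1 := by
    rw [Params.eta, inv_pow]
    exact mul_inv_cancel₀ (pow_ne_zero _ (Nat.cast_ne_zero.2 P.L_pos.ne'))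
  rw [Nat.cast_pow, Nat.cast_pow, ← pow_mul, mul_comm P.d k, pow_mul, ← mul_pow, hLη, one_pow]

/-! ## §1  The GL pin with {W1}'s onto row, the current letter and the window reduced by name -/

section Guarded

variable (K k : ℕ) (Ω : ℕ → Set (Site (F.P K) 0)) (U₀ : GaugeField (F.P K) 0 (SU N))
variable [Fact (0 < (F.L : ℝ))] [Fact (0 < (F.P K).eta k)] [Fact (0 < c0Rec F K k)] [Fact (∀ c, 0 < wBRec F K k c)]

/-- ★★★ **THE GL PIN, GUARDED EDITION — {W1}'s `hQ`, the current letter `hJ` AND the window `hq` REDUCED BY NAME**: ✓`…hierFrameGLRec_of_entryRows` (✓p833890 §2) with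
(a) `hQ : Q^{pr}(U₀; 𝔥ᴳᴸ) onto` ⟸ the UN-FRAMED onto row `Function.Surjective (qCplxOp k U₀)` of [B7] Sect. E (✓`QprOfRecord_surjective_hierFrameGL_of_qCplxOp`; its guard
`SmallBelow (avOfRecord) k U₀` is print's (14) `hreg` by ✓`C44IterMh.loopProfile_of_regular_below`), (b) `‖J(U₀)‖₍₋₃₎ ≤ nJ` ⟸ [B11] (2)'s class at `Ω_j = T`, `InUkClassB11 F N K k ε₀ U₀`,
`nJ := ε₀` (✓`norm_JOfRecordAtBg_le_of_inUkClassB11` = [B11] Thm 1 (8)∕(28) by name), (c) the window `(r+r)·Θ_H·G ≤ ½` in its k-FREE form `(r+r)·b·2dC₃ ≤ ½` (`Θ_H = (L^d)^k·b`,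
`G = 2dC₃η_k^d`, `(L^d)^k·η_k^d = 1`).  REMAINING displayed letters: `hpos` ({W1}, framed Laplacian positive), `hqon` (un-framed onto), {W2} `h0∕h1`, {W3} `hS∕hR`, {W4} `h157` + `r+r ≤ α₁`,
the k-free window, `InUkClassB11 … ε₀ U₀`, (14) `hreg`, `∀ x, x ∈ Ω_k`, numeric format rows.  Glue BY NAME; nothing of [B7]∕[B9]∕[B11] proved; {W1}–{W4} INHABITED NOWHERE.
[cite: Balaban1985Variational, Prop. 4 (97)–(98) pp.292–293, (2) p.278, (8) p.279, (14) p.280, (28) p.282, (45)–(46) p.285, (72)–(73) p.289, (86)–(89) p.291, (103) p.293; Balaban1985Averaging, Proposition 5 (157) p.42, (84)–(92) pp.30–31; Balaban1985BackgroundPropagators, Thm 3.12 (3.132)–(3.133) p.422, (3.113)–(3.115) p.418; Balaban1987RG1, (1.2) p.260] -/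
theorem prop4UniformPrAtRecord_node00_of_prop5Clause_hierFrameGLRec_of_entryRows_guarded (levB : PBond (F.P K) k → ℕ) (a : ℝ)
    (hpos : ∀ x, x ≠ 0 → 0 < RCLike.re ⟪x, laplaceAOfRecord F N k U₀ (QprOfRecord F N k U₀ (hierFrameGLDatumOfRecord F N k U₀)) (QprimeOfRecord F N k U₀) a x⟫_ℂ)
    (Gp : SiteL2K ℂ (F.P K).d (fun _ => (F.P K).sitesPerDir 0) (c0Rec F K k) (WRec N) →ₗ[ℂ]
      SiteL2K ℂ (F.P K).d (fun _ => (F.P K).sitesPerDir 0) (c0Rec F K k) (WRec N))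
    {α ε₀ : ℝ} (hkpos : 0 < k) (hkm : k ≤ (F.P K).m + (F.P K).K) (hΩ : ∀ x, x ∈ Ω k) (hαpos : 0 < α) (hα : α * (11000000 * N) ≤ 1)
    (hreg : ∀ j, j < k → PlaqSmall (α * ((F.L : ℝ) ^ j * (F.P K).eta k) ^ 2) (Averaging.iter (avOfRecord F N K) j U₀))
    -- {W1}'s `hQ` REDUCED: the un-framed onto row of [B7] Sect. E (✓`QprOfRecord_surjective_hierFrameGL_of_qCplxOp`, guard below `k` from `hreg` by ✓`loopProfile_of_regular_below`)
    (hqon : Function.Surjective (qCplxOp k U₀))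
    -- {W2} := the (3.133) entry rows of `H₁^{pr}(U₀)` at `(B₀, ρ)` ([B9] Thm 3.12; lane N07) — DISPLAYED
    {B₀ ρ : ℝ} (hB₀ : 0 ≤ B₀) (hρ : 0 < ρ)
    (h0 : ∀ y'' y : PBond (F.P K) k, entry0 F N K k Ω U₀ levB (H1prOfRecordAtBg F N K k Ω U₀ (hierFrameGLDatumOfRecord F N k U₀) levB a hpos
      (N07QprOfRecordOntoGuarded.QprOfRecord_surjective_hierFrameGL_of_qCplxOp F N K k U₀ hkm (C44IterMh.loopProfile_of_regular_below F N k U₀ le_rfl hαpos.le hα hreg).1 hqon)) y'' y ≤ B₀ * Real.exp (-(ρ * (Site.tdist y''.src y.src : ℝ))))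
    (h1 : ∀ y'' y : PBond (F.P K) k, entry1 F N K k Ω U₀ levB (H1prOfRecordAtBg F N K k Ω U₀ (hierFrameGLDatumOfRecord F N k U₀) levB a hpos
      (N07QprOfRecordOntoGuarded.QprOfRecord_surjective_hierFrameGL_of_qCplxOp F N K k U₀ hkm (C44IterMh.loopProfile_of_regular_below F N k U₀ le_rfl hαpos.le hα hreg).1 hqon)) y'' y ≤ B₀ * Real.exp (-(ρ * (Site.tdist y''.src y.src : ℝ))))
    -- (KL-C)ᵖʳ := the (157) clause of `B7.Prop5Printed (kexpOfRecordPr F N 𝔥ᴳᴸ)` at `(α, α₁, C₃)`, `r + r ≤ α₁`, and the window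
    {C₃ α₁ : ℝ} (hC₃ : 0 ≤ C₃)
    (h157 : ∀ (i : KRecIdx F) (U₀ : (kexpOfRecordPr F N (fun K k (U₀ : GaugeField (F.P K) 0 (SU N)) => hierFrameGLDatumOfRecord F N k U₀) i).Cfg), (kexpOfRecordPr F N (fun K k (U₀ : GaugeField (F.P K) 0 (SU N)) => hierFrameGLDatumOfRecord F N k U₀) i).plaqDevEta U₀ < α →
      ∀ A : (kexpOfRecordPr F N (fun K k (U₀ : GaugeField (F.P K) 0 (SU N)) => hierFrameGLDatumOfRecord F N k U₀) i).Fld, (kexpOfRecordPr F N (fun K k (U₀ : GaugeField (F.P K) 0 (SU N)) => hierFrameGLDatumOfRecord F N k U₀) i).fldNorm A < α₁ → (kexpOfRecordPr F N (fun K k (U₀ : GaugeField (F.P K) 0 (SU N)) => hierFrameGLDatumOfRecord F N k U₀) i).dCk U₀ A ≤ C₃ * (kexpOfRecordPr F N (fun K k (U₀ : GaugeField (F.P K) 0 (SU N)) => hierFrameGLDatumOfRecord F N k U₀) i).fldNorm A)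
    (hrα₁ : letI b : ℝ := B₀ * ((F.P K).d * (2 * (1 + 1 / ρ)) ^ (F.P K).d)
      letI C₂ : ℝ := 281600000000000000 * (F.L : ℝ) * N
      letI c₄ : ℝ := 1 / (200000000000 * (F.L : ℝ) * N)
      letI r : ℝ := min (c₄ / 4) (min (1 / 2) (1 / (16 * (b * C₂ + 1))))
      r + r ≤ α₁)
    -- the window, k-FREE: `(r+r)·Θ_H·G = (r+r)·b·2dC₃ · ((L^d)^k η_k^d) = (r+r)·b·2dC₃` since `L^k η_k = 1`
    (hq : letI b : ℝ := B₀ * ((F.P K).d * (2 * (1 + 1 / ρ)) ^ (F.P K).d)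
      letI C₂ : ℝ := 281600000000000000 * (F.L : ℝ) * N
      letI c₄ : ℝ := 1 / (200000000000 * (F.L : ℝ) * N)
      letI r : ℝ := min (c₄ / 4) (min (1 / 2) (1 / (16 * (b * C₂ + 1))))
      (r + r) * b * (2 * ((F.P K).d : ℝ) * C₃) ≤ 1 / 2)
    -- {W3} := the locality rows of the current reader `Δπ(U₀; G′, Q′)` ([B11] (72)–(73)∕(86)–(89)): (L) fine majorants `s₀, s₁`, (R) block-aggregated row decay — DISPLAYED
    {s0 : Bond (F.P K).d (fun _ => (F.P K).sitesPerDir 0) → Bond (F.P K).d (fun _ => (F.P K).sitesPerDir 0) → ℝ} {s1 : Bond (F.P K).d (fun _ => (F.P K).sitesPerDir 0) → Bond (F.P K).d (fun _ => (F.P K).sitesPerDir 0) × Fin (F.P K).d → ℝ} (hs0 : ∀ b' x, 0 ≤ s0 b' x) (hs1 : ∀ b' p, 0 ≤ s1 b' p)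
    (hS : ∀ (A : Space115Lit F N K k Ω U₀) (b' : Bond (F.P K).d (fun _ => (F.P K).sitesPerDir 0)),
      ‖NegSup.equiv (levWeight (F.L : ℝ) ((F.P K).eta k) (bondLevLit F Ω k) 3) (Matrix (Fin N) (Fin N) ℂ) (DeltaPiCurOfRecord F N K k Ω U₀ Gp (QprimeOfRecord F N k U₀) A) b'‖ ≤
        ∑ x : Bond (F.P K).d (fun _ => (F.P K).sitesPerDir 0), s0 b' x * ‖JetSup.equiv _ _ _ A x‖ +
        ∑ p : Bond (F.P K).d (fun _ => (F.P K).sitesPerDir 0) × Fin (F.P K).d, s1 b' p * ‖(nabla115 ((F.P K).eta k) (unitsOfRecord F N U₀)) (JetSup.equiv _ _ _ A) p‖)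
    {Cπ σ : ℝ} (hCπ : 0 ≤ Cπ) (hσ : 0 < σ)
    (hR : ∀ (b' : Bond (F.P K).d (fun _ => (F.P K).sitesPerDir 0)) (y'' : PBond (F.P K) k),
      blockRow0 F K k s0 b' y'' + blockRow1 F K k s1 b' y'' ≤
        Cπ * Real.exp (-(σ * (Site.tdist (blkOfBond F K k b').src y''.src : ℝ))))
    -- the current letter `‖J(U₀)‖ ≤ nJ` REDUCED: [B11] (2)'s class at `Ω_j = T` gives `nJ := ε₀` (✓`norm_JOfRecordAtBg_le_of_inUkClassB11`)
    (hε₀ : 0 ≤ ε₀) (hcl : InUkClassB11 F N K k ε₀ U₀) :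
    letI b : ℝ := B₀ * ((F.P K).d * (2 * (1 + 1 / ρ)) ^ (F.P K).d)
    letI ΘHw : ℝ := ((((F.P K).L ^ (F.P K).d) ^ k : ℕ) : ℝ) * b
    letI N₁ : ℝ := Cπ * B₀ * ((F.P K).d * (2 * (1 + 1 / (min σ ρ / 2))) ^ (F.P K).d) * ((F.P K).d * (2 * (1 + 1 / (min σ ρ / 2))) ^ (F.P K).d)
    letI Θ' : ℝ := ((((F.P K).L ^ (F.P K).d) ^ k : ℕ) : ℝ) * N₁
    letI C₂ : ℝ := 281600000000000000 * (F.L : ℝ) * N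
    letI c₄ : ℝ := 1 / (200000000000 * (F.L : ℝ) * N)
    letI r : ℝ := min (c₄ / 4) (min (1 / 2) (1 / (16 * (b * C₂ + 1))))
    letI R' : ℝ := min r ((1 - 4 * b * C₂ * (r + r)) * (1 / 16))
    letI CV : ℝ := 1024 * (((F.P K).d - 1 : ℕ) : ℝ) * ((1 : ℝ) * 1) ^ 3 * N * (α * (1 : ℝ) ^ 2 + 1 / 16)
        + (((F.P K).d - 1 : ℕ) : ℝ) * ((1 : ℝ) * 1) ^ 3 * (136 + 2 * ((1 : ℝ) * 1)) * N
    letI G : ℝ := 2 * ((F.P K).d : ℝ) * (C₃ * (F.P K).eta k ^ (F.P K).d)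
    letI θ₃ : ℝ := (2 * (1 / (1 - 4 * b * C₂ * (r + r))) + 1) * ΘHw * G / r
    letI θE : ℝ := 2 * ΘHw * G * (1 / (1 - 4 * b * C₂ * (r + r)))
    letI θE' : ℝ := 2 * Θ' * G * (1 / (1 - 4 * b * C₂ * (r + r)))
    Prop4UniformPrAtRecord F N K k Ω U₀ (hierFrameGLDatumOfRecord F N k U₀) levB a hpos
      (N07QprOfRecordOntoGuarded.QprOfRecord_surjective_hierFrameGL_of_qCplxOp F N K k U₀ hkm (C44IterMh.loopProfile_of_regular_below F N k U₀ le_rfl hαpos.le hα hreg).1 hqon) r Gp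
      ((N * θ₃ * ε₀ + (N₁ * C₂ * (1 / (1 - 4 * b * C₂ * (r + r))) ^ 2 + N * θE')
        + N * θE * (N₁ * C₂ * (1 / (1 - 4 * b * C₂ * (r + r))) ^ 2) * R'
        + N * (1 + θE * R') * CV * (1 / (1 - 4 * b * C₂ * (r + r))) ^ 2)) R' := by
  have hone : ((((F.P K).L ^ (F.P K).d) ^ k : ℕ) : ℝ) * (F.P K).eta k ^ (F.P K).d = 1 := natCast_blocks_mul_eta_pow_eq_one (F.P K) k
  have e : ∀ r' b' : ℝ, (r' + r') * (((((F.P K).L ^ (F.P K).d) ^ k : ℕ) : ℝ) * b') * (2 * ((F.P K).d : ℝ) * (C₃ * (F.P K).eta k ^ (F.P K).d)) =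
      (r' + r') * b' * (2 * ((F.P K).d : ℝ) * C₃) * (((((F.P K).L ^ (F.P K).d) ^ k : ℕ) : ℝ) * (F.P K).eta k ^ (F.P K).d) := fun r' b' => by ring
  have hq' : letI b : ℝ := B₀ * ((F.P K).d * (2 * (1 + 1 / ρ)) ^ (F.P K).d)
      letI ΘH : ℝ := ((((F.P K).L ^ (F.P K).d) ^ k : ℕ) : ℝ) * b
      letI C₂ : ℝ := 281600000000000000 * (F.L : ℝ) * N
      letI c₄ : ℝ := 1 / (200000000000 * (F.L : ℝ) * N)
      letI r : ℝ := min (c₄ / 4) (min (1 / 2) (1 / (16 * (b * C₂ + 1))))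
      (r + r) * ΘH * (2 * ((F.P K).d : ℝ) * (C₃ * (F.P K).eta k ^ (F.P K).d)) ≤ 1 / 2 := by
    rw [e, hone, mul_one]
    exact hq
  exact prop4UniformPrAtRecord_node00_of_prop5Clause_hierFrameGLRec_of_entryRows F N K k Ω U₀ levB a hpos
    (N07QprOfRecordOntoGuarded.QprOfRecord_surjective_hierFrameGL_of_qCplxOp F N K k U₀ hkm (C44IterMh.loopProfile_of_regular_below F N k U₀ le_rfl hαpos.le hα hreg).1 hqon) Gp hkpos hkm hΩ hαpos hα hreg hB₀ hρ h0 h1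
    hC₃ h157 hrα₁ hq' hs0 hs1 hS hCπ hσ hR (N07JOfRecordBoundOfThm1Class.norm_JOfRecordAtBg_le_of_inUkClassB11 F N k Ω U₀ hε₀ hcl)

end Guarded

end Summit.QuantumFields.YangMills.Theorems.KExpOfRecordPr

end
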